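import Summits.BirchSwinnertonDyer.BirchSwinnertonDyer.Theses.LeadingTerm

/-!
# BirchSwinnertonDyer — crux `SqueezeUB(R2)` (stmt-BirchSwinnertonDyer-0145 = stmt-0496, routes
# LeadingTerm · Squeeze · HigherGrossZagier): negative lemma (standing disprover, cycle 1)

Load-bearing analysis of `∀ (W : WeierstrassCurve ℚ) [W.IsElliptic], W.mordellWeilRank ≤ W.analyticRank`
("no excess rank") as kernel-checked theorems; no route statement is asserted positively, and no
definition or notation is introduced (the witness is written as the literal `⟨0, 0, 0, 0, 0⟩`).

The only hypothesis `[W.IsElliptic]` (`Δ ≠ 0`) is LOAD-BEARING: the binder-free statement is FALSE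
(`squeezeUB_false_without_isElliptic`). Witness: the cuspidal cubic `y² = x³` = `⟨0, 0, 0, 0, 0⟩`:
* analytic side — every model over every completion has `Δ = c₄ = 0`, so Mathlib's local polynomial is
  the additive `1` at EVERY place, `LFunction = ∏' 1 = 1`, `LSeries ≡ 1`, the entire continuation is
  the constant `1`, `analyticRank = 0` (`squeezeUB_cusp_analyticRank`);
* algebraic side — the nonsingular points are `(t², t³)`, `t ∈ ℚˣ`, the chord–tangent law is
  `(t₁², t₁³) + (t₂², t₂³) = ((t₁t₂/(t₁+t₂))², (t₁t₂/(t₁+t₂))³)` (`squeezeUB_cusp_some_add_some`, direct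
  computation with Mathlib's `slope`/`addX`/`addY`), so `(x, y) ↦ x / y = 1/t` is an INJECTIVE
  homomorphism `E_ns(ℚ) →+ (ℚ, +)` (Silverman AEC III.2.5; `squeezeUB_cusp_exists_addMonoidHom`), whence
  `rank_ℤ E_ns(ℚ) ≤ rank_ℤ ℚ = 1` and `(1,1)` has infinite order:
  `mordellWeilRank = finrank ℤ E_ns(ℚ) = 1` (`squeezeUB_cusp_mordellWeilRank`; the tree's
  `mordellWeilRank` carries the classical `DecidableEq ℚ`, bridged by `convert`).
REMARK: the docstring of `WeierstrassCurve.mordellWeilRank` ("junk `0` if not finitely generated") is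
inaccurate — `finrank ℤ ℚ = 1`; `finrank` is `0` only for INFINITE rank (nodal cubics). For elliptic `W`
Mordell–Weil is proved in tree (`module_finite_point_holds`), so `mordellWeilRank` is the true rank.
Full adversarial record: `Cruxes/SqueezeUB/Disproof.lean` (why the crux itself resists).
-/

set_option linter.dupNamespace false

namespace Summit.BirchSwinnertonDyer.BirchSwinnertonDyer.Theorems

open WeierstrassCurve ArithmeticFunction IsDedekindDomain NumberField Filter

/-! ## The witness `y² = x³`: invariants -/

/-- `Δ(y² = x³) = 0`: the curve is singular (NOT `IsElliptic`). [folklore] -/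
theorem squeezeUB_cusp_Δ : (⟨0, 0, 0, 0, 0⟩ : WeierstrassCurve ℚ).Δ = 0 := by
  simp [WeierstrassCurve.Δ, WeierstrassCurve.b₂, WeierstrassCurve.b₄, WeierstrassCurve.b₆,
    WeierstrassCurve.b₈]

/-- `c₄(y² = x³) = 0`: the singularity is a cusp. [folklore] -/
theorem squeezeUB_cusp_c₄ : (⟨0, 0, 0, 0, 0⟩ : WeierstrassCurve ℚ).c₄ = 0 := by
  simp [WeierstrassCurve.c₄, WeierstrassCurve.b₂, WeierstrassCurve.b₄]

/-- The cusp is not an elliptic curve (`Δ = 0`). [folklore] -/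
theorem squeezeUB_not_isElliptic_cusp : ¬ (⟨0, 0, 0, 0, 0⟩ : WeierstrassCurve ℚ).IsElliptic :=
  fun h ↦ by simpa [squeezeUB_cusp_Δ] using h.isUnit

/-! ### The analytic side: `L(y² = x³, s) ≡ 1`, `analyticRank = 0` -/

section Local

variable (R : Type*) [CommRing R] [IsDomain R] [IsDiscreteValuationRing R] {K : Type*}
  [Field K] [Algebra R K] [IsFractionRing R K]

/-- A Weierstrass equation with `Δ = 0` and `c₄ = 0` over the fraction field of a DVR has Mathlib
local polynomial `1`: every model `C • W` again has `Δ = c₄ = 0` (`variableChange_Δ`,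
`variableChange_c₄`), so the chosen minimal model has valuation `v(0) = 0 < 1` of both, i.e.
`HasAdditiveReduction`, which is neither good nor (split) multiplicative (Silverman AEC App. C §16:
`L_v(T) = 1` at additive places). [cite: SilvermanAEC2009, App. C §16] -/
theorem squeezeUB_localPolynomial_eq_one_of_Δ_eq_zero_of_c₄_eq_zero (W : WeierstrassCurve K)
    (hΔ : W.Δ = 0) (hc₄ : W.c₄ = 0) : W.localPolynomial R = 1 := by
  have hΔ' : (W.minimal R).Δ = 0 := by
    rw [WeierstrassCurve.minimal, variableChange_Δ, hΔ, mul_zero]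
  have hc₄' : (W.minimal R).c₄ = 0 := by
    rw [WeierstrassCurve.minimal, variableChange_c₄, hc₄, mul_zero]
  have hadd : (W.minimal R).HasAdditiveReduction R := by
    refine (hasAdditiveReduction_iff R _).mpr ⟨inferInstance, ?_, ?_⟩
    · rw [hΔ', _root_.map_zero]; exact zero_lt_one
    · rw [hc₄', _root_.map_zero]; exact zero_lt_one
  unfold localPolynomial
  rw [if_neg hadd.not_hasGoodReduction, if_neg, if_neg hadd.not_hasMultiplicativeReduction]
  exact fun hs ↦ hadd.not_hasMultiplicativeReduction _ hs.toHasMultiplicativeReduction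

/-- … hence local Euler factor `1` (the Dirichlet series `1`). [folklore] -/
theorem squeezeUB_localEulerFactor_eq_one_of_Δ_eq_zero_of_c₄_eq_zero (W : WeierstrassCurve K)
    (hΔ : W.Δ = 0) (hc₄ : W.c₄ = 0) : W.localEulerFactor R = 1 := by
  have hps : W.localPowerSeries R = 1 := by
    rw [localPowerSeries, squeezeUB_localPolynomial_eq_one_of_Δ_eq_zero_of_c₄_eq_zero R W hΔ hc₄,
      Polynomial.coe_one]
    have := PowerSeries.mul_invOfUnit (1 : PowerSeries ℤ) 1 (by simp)
    rwa [one_mul] at this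
  rw [localEulerFactor, hps, map_one]

end Local

/-- The Euler product of the constant family `1` is `1` (via the outward-facing API
`tendsTo_eulerProduct_of_tendsTo`: all partial products are `1`). [folklore] -/
theorem squeezeUB_eulerProduct_one {ι : Type*} :
    eulerProduct (fun _ : ι ↦ (1 : ArithmeticFunction ℤ)) = 1 := by
  ext n
  have h := tendsTo_eulerProduct_of_tendsTo (fun _ : ι ↦ (1 : ArithmeticFunction ℤ))
    (fun n ↦ Eventually.of_forall fun _ ↦ rfl) n
  obtain ⟨s, hs⟩ := h.exists
  rw [Finset.prod_const_one] at hs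
  exact hs.symm

/-- `L(y² = x³, s)` as a formal Dirichlet series is `1`: every local factor is the additive `1`.
[folklore] -/
theorem squeezeUB_cusp_LFunction : (⟨0, 0, 0, 0, 0⟩ : WeierstrassCurve ℚ).LFunction = 1 := by
  have h : (fun v : HeightOneSpectrum (𝓞 ℚ) ↦
      ((⟨0, 0, 0, 0, 0⟩ : WeierstrassCurve ℚ).baseChange (v.adicCompletion ℚ)).localEulerFactor
        (v.adicCompletionIntegers ℚ)) = fun _ ↦ 1 := by
    funext v
    apply squeezeUB_localEulerFactor_eq_one_of_Δ_eq_zero_of_c₄_eq_zero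
    · rw [baseChange, map_Δ, squeezeUB_cusp_Δ, _root_.map_zero]
    · rw [baseChange, map_c₄, squeezeUB_cusp_c₄, _root_.map_zero]
  change eulerProduct _ = 1
  rw [h, squeezeUB_eulerProduct_one]

/-- `L(y² = x³, s) = 1` for every `s` (`LSeries δ = 1`). [folklore] -/
theorem squeezeUB_cusp_LSeries : (⟨0, 0, 0, 0, 0⟩ : WeierstrassCurve ℚ).LSeries = fun _ ↦ 1 := by
  funext s
  change LSeries (fun n ↦ (((⟨0, 0, 0, 0, 0⟩ : WeierstrassCurve ℚ).LFunction n : ℤ) : ℂ)) s = 1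
  rw [squeezeUB_cusp_LFunction]
  have : (fun n ↦ (((1 : ArithmeticFunction ℤ) n : ℤ) : ℂ)) = LSeries.delta := by
    funext n
    simp only [one_apply, LSeries.delta]
    split_ifs <;> simp
  rw [this, LSeries_delta, Pi.one_apply]

/-- The constant `1` is an entire continuation of `L(y² = x³, s)`. [folklore] -/
theorem squeezeUB_cusp_hasEntireLFunction : (⟨0, 0, 0, 0, 0⟩ : WeierstrassCurve ℚ).HasEntireLFunction :=
  ⟨fun _ ↦ 1, differentiable_const 1, fun s _ ↦ by rw [squeezeUB_cusp_LSeries]⟩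

/-- The chosen entire continuation of `L(y² = x³, s)` IS the constant `1` (uniqueness of entire
continuations, `subsingleton_entireContinuations`). [folklore] -/
theorem squeezeUB_cusp_entireLFunction : (⟨0, 0, 0, 0, 0⟩ : WeierstrassCurve ℚ).entireLFunction = fun _ ↦ 1 :=
  (⟨0, 0, 0, 0, 0⟩ : WeierstrassCurve ℚ).subsingleton_entireContinuations
    ((⟨0, 0, 0, 0, 0⟩ : WeierstrassCurve ℚ).entireLFunction_mem squeezeUB_cusp_hasEntireLFunction)
    ⟨differentiable_const 1, fun s _ ↦ by rw [squeezeUB_cusp_LSeries]⟩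

/-- **`r_an(y² = x³) = 0`**: the order of vanishing of the constant `1` at `s = 1`. [folklore] -/
theorem squeezeUB_cusp_analyticRank : (⟨0, 0, 0, 0, 0⟩ : WeierstrassCurve ℚ).analyticRank = 0 := by
  have h : analyticOrderAt (fun _ : ℂ ↦ (1 : ℂ)) 1 = 0 :=
    (analyticAt_const).analyticOrderAt_eq_zero.mpr one_ne_zero
  simp [WeierstrassCurve.analyticRank, analyticOrderNatAt, squeezeUB_cusp_entireLFunction, h]

/-! ### The algebraic side: `E_ns(ℚ) ↪ (ℚ, +)`, `mordellWeilRank = 1` -/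

/-- The affine equation of the cusp is `y² = x³`. [folklore] -/
theorem squeezeUB_cusp_equation_iff (x y : ℚ) : (⟨0, 0, 0, 0, 0⟩ : WeierstrassCurve ℚ).toAffine.Equation x y ↔ y ^ 2 = x ^ 3 := by
  rw [Affine.equation_iff]
  simp

/-- The nonsingular rational points of `y² = x³` are the `(x, y)` on the curve with `y ≠ 0`
(the cusp `(0,0)` is the only singular point). [folklore] -/
theorem squeezeUB_cusp_nonsingular_iff (x y : ℚ) :
    (⟨0, 0, 0, 0, 0⟩ : WeierstrassCurve ℚ).toAffine.Nonsingular x y ↔ y ^ 2 = x ^ 3 ∧ y ≠ 0 := by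
  rw [Affine.nonsingular_iff', squeezeUB_cusp_equation_iff]
  simp only [zero_mul, mul_zero, add_zero, zero_sub, ne_eq, neg_eq_zero]
  constructor
  · rintro ⟨h, h'⟩
    refine ⟨h, fun hy ↦ ?_⟩
    subst hy
    have hx : x = 0 := by
      have : x ^ 3 = 0 := by rw [← h]; ring
      exact pow_eq_zero_iff (by norm_num) |>.mp this
    subst hx
    simp at h'
  · rintro ⟨h, hy⟩
    exact ⟨h, Or.inr (by simpa using hy)⟩

/-- Parametrisation: every nonsingular point of the cusp is `(t², t³)` with `t = y/x ≠ 0`.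
[folklore] -/
theorem squeezeUB_cusp_param {x y : ℚ} (h : (⟨0, 0, 0, 0, 0⟩ : WeierstrassCurve ℚ).toAffine.Nonsingular x y) :
    ∃ t : ℚ, t ≠ 0 ∧ x = t ^ 2 ∧ y = t ^ 3 := by
  rw [squeezeUB_cusp_nonsingular_iff] at h
  obtain ⟨h, hy⟩ := h
  have hx : x ≠ 0 := by
    rintro rfl
    apply hy
    have : y ^ 2 = 0 := by rw [h]; ring
    exact pow_eq_zero_iff (by norm_num) |>.mp this
  refine ⟨y / x, div_ne_zero hy hx, ?_, ?_⟩
  · field_simp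
    rw [h]
  · have : (y / x) ^ 3 = (y / x) ^ 2 * (y / x) := by ring
    rw [this]
    field_simp
    rw [h]

/-- `(t², t³)` is a nonsingular point for `t ≠ 0`. [folklore] -/
theorem squeezeUB_cusp_nonsingular_param {t : ℚ} (ht : t ≠ 0) :
    (⟨0, 0, 0, 0, 0⟩ : WeierstrassCurve ℚ).toAffine.Nonsingular (t ^ 2) (t ^ 3) := by
  rw [squeezeUB_cusp_nonsingular_iff]
  exact ⟨by ring, pow_ne_zero 3 ht⟩

/-- **The chord–tangent law on the cusp** (Silverman AEC III.2.5, `E_ns ≅ 𝔾ₐ` via `t ↦ 1/t`): for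
`t₁, t₂ ≠ 0` with `t₁ + t₂ ≠ 0`, `(t₁², t₁³) + (t₂², t₂³) = (t₃², t₃³)` with `t₃ = t₁t₂/(t₁+t₂)`,
i.e. `1/t₃ = 1/t₁ + 1/t₂`. Direct computation with Mathlib's `slope` (`= (t₁² + t₁t₂ + t₂²)/(t₁+t₂)`
in the secant and the tangent case alike), `addX`, `addY`. [cite: SilvermanAEC2009, Prop. III.2.5] -/
theorem squeezeUB_cusp_some_add_some {t₁ t₂ : ℚ} (ht₁ : t₁ ≠ 0) (ht₂ : t₂ ≠ 0) (hsum : t₁ + t₂ ≠ 0) :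
    (Affine.Point.some _ _ (squeezeUB_cusp_nonsingular_param ht₁) : (⟨0, 0, 0, 0, 0⟩ : WeierstrassCurve ℚ).toAffine.Point) +
        Affine.Point.some _ _ (squeezeUB_cusp_nonsingular_param ht₂) =
      Affine.Point.some _ _ (squeezeUB_cusp_nonsingular_param
        (div_ne_zero (mul_ne_zero ht₁ ht₂) hsum : t₁ * t₂ / (t₁ + t₂) ≠ 0)) := by
  have hxy : ¬ (t₁ ^ 2 = t₂ ^ 2 ∧ t₁ ^ 3 = (⟨0, 0, 0, 0, 0⟩ : WeierstrassCurve ℚ).toAffine.negY (t₂ ^ 2) (t₂ ^ 3)) := by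
    rintro ⟨hx, hy⟩
    simp only [Affine.negY, zero_mul, sub_zero] at hy
    rcases eq_or_eq_neg_of_sq_eq_sq _ _ hx with h | h
    · subst h
      have : t₁ ^ 3 = 0 := by linarith
      exact ht₁ (pow_eq_zero_iff (by norm_num) |>.mp this)
    · apply hsum; linarith
  have hL : (⟨0, 0, 0, 0, 0⟩ : WeierstrassCurve ℚ).toAffine.slope (t₁ ^ 2) (t₂ ^ 2) (t₁ ^ 3) (t₂ ^ 3) =
      (t₁ ^ 2 + t₁ * t₂ + t₂ ^ 2) / (t₁ + t₂) := by
    by_cases hx : t₁ ^ 2 = t₂ ^ 2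
    · -- tangent case `t₁ = t₂`
      have ht : t₁ = t₂ := by
        rcases eq_or_eq_neg_of_sq_eq_sq _ _ hx with h | h
        · exact h
        · exfalso; apply hsum; linarith
      subst ht
      have hy : t₁ ^ 3 ≠ (⟨0, 0, 0, 0, 0⟩ : WeierstrassCurve ℚ).toAffine.negY (t₁ ^ 2) (t₁ ^ 3) :=
        fun h ↦ hxy ⟨rfl, h⟩
      rw [Affine.slope_of_Y_ne rfl hy]
      simp only [Affine.negY, zero_mul, mul_zero, add_zero, sub_zero]
      field_simp
      ring
    · -- secant case
      rw [Affine.slope_of_X_ne hx]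
      have h1 : t₁ - t₂ ≠ 0 := by
        intro h; apply hx; have : t₁ = t₂ := by linarith
        rw [this]
      have h2 : t₁ ^ 2 - t₂ ^ 2 ≠ 0 := sub_ne_zero.mpr hx
      field_simp
      ring
  have hX : (⟨0, 0, 0, 0, 0⟩ : WeierstrassCurve ℚ).toAffine.addX (t₁ ^ 2) (t₂ ^ 2)
      ((⟨0, 0, 0, 0, 0⟩ : WeierstrassCurve ℚ).toAffine.slope (t₁ ^ 2) (t₂ ^ 2) (t₁ ^ 3) (t₂ ^ 3)) =
        (t₁ * t₂ / (t₁ + t₂)) ^ 2 := by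
    rw [hL]
    simp only [Affine.addX, zero_mul, add_zero, sub_zero]
    field_simp
    ring
  have hY : (⟨0, 0, 0, 0, 0⟩ : WeierstrassCurve ℚ).toAffine.addY (t₁ ^ 2) (t₂ ^ 2) (t₁ ^ 3)
      ((⟨0, 0, 0, 0, 0⟩ : WeierstrassCurve ℚ).toAffine.slope (t₁ ^ 2) (t₂ ^ 2) (t₁ ^ 3) (t₂ ^ 3)) =
        (t₁ * t₂ / (t₁ + t₂)) ^ 3 := by
    rw [Affine.addY, Affine.negAddY, hX, hL]
    simp only [Affine.negY, zero_mul, sub_zero]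
    field_simp
    ring
  rw [Affine.Point.add_some hxy, Affine.Point.some.injEq]
  exact ⟨hX, hY⟩

/-- Opposite points: `(t², t³) + (t², -t³) = O` on the cusp. [folklore] -/
theorem squeezeUB_cusp_some_add_some_neg {t : ℚ} (ht : t ≠ 0) :
    (Affine.Point.some _ _ (squeezeUB_cusp_nonsingular_param ht) : (⟨0, 0, 0, 0, 0⟩ : WeierstrassCurve ℚ).toAffine.Point) +
        Affine.Point.some _ _ (squeezeUB_cusp_nonsingular_param (neg_ne_zero.mpr ht)) = 0 :=
  Affine.Point.add_of_Y_eq (by ring) (by simp [Affine.negY]; ring)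

/-- **`E_ns(ℚ) ↪ (ℚ, +)`**: there is an injective group homomorphism from the nonsingular points of
the cusp to `ℚ` taking `(1, 1)` to `1` — namely `(x, y) ↦ x / y` (`= 1/t` on `(t², t³)`),
`O ↦ 0` (Silverman AEC III.2.5). [cite: SilvermanAEC2009, Prop. III.2.5] -/
theorem squeezeUB_cusp_exists_addMonoidHom :
    ∃ φ : (⟨0, 0, 0, 0, 0⟩ : WeierstrassCurve ℚ).toAffine.Point →+ ℚ, Function.Injective φ ∧
      φ (Affine.Point.some _ _ (squeezeUB_cusp_nonsingular_param one_ne_zero)) = 1 := by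
  let f : (⟨0, 0, 0, 0, 0⟩ : WeierstrassCurve ℚ).toAffine.Point → ℚ := fun P ↦ match P with
    | .zero => 0
    | .some x y _ => x / y
  have hf : ∀ {t : ℚ} (ht : t ≠ 0) (h : (⟨0, 0, 0, 0, 0⟩ : WeierstrassCurve ℚ).toAffine.Nonsingular (t ^ 2) (t ^ 3)),
      f (.some _ _ h) = t⁻¹ := by
    intro t ht h
    change t ^ 2 / t ^ 3 = t⁻¹
    field_simp
  have hadd : ∀ P Q : (⟨0, 0, 0, 0, 0⟩ : WeierstrassCurve ℚ).toAffine.Point, f (P + Q) = f P + f Q := by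
    rintro (_ | ⟨x₁, y₁, h₁⟩) Q
    · change f Q = 0 + f Q
      rw [zero_add]
    have hf0 : f Affine.Point.zero = 0 := rfl
    rcases Q with _ | ⟨x₂, y₂, h₂⟩
    · have e : (Affine.Point.some x₁ y₁ h₁ : (⟨0, 0, 0, 0, 0⟩ : WeierstrassCurve ℚ).toAffine.Point) +
          Affine.Point.zero = Affine.Point.some x₁ y₁ h₁ := add_zero _
      rw [e, hf0, add_zero]
    obtain ⟨t₁, ht₁, rfl, rfl⟩ := squeezeUB_cusp_param h₁
    obtain ⟨t₂, ht₂, rfl, rfl⟩ := squeezeUB_cusp_param h₂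
    by_cases hsum : t₁ + t₂ = 0
    · have ht : t₂ = -t₁ := by linarith
      subst ht
      rw [hf ht₁ h₁, hf ht₂ h₂, squeezeUB_cusp_some_add_some_neg ht₁, hf0]
      field_simp
      ring
    · have hne : t₁ * t₂ / (t₁ + t₂) ≠ 0 := div_ne_zero (mul_ne_zero ht₁ ht₂) hsum
      rw [hf ht₁ h₁, hf ht₂ h₂, squeezeUB_cusp_some_add_some ht₁ ht₂ hsum,
        hf hne (squeezeUB_cusp_nonsingular_param hne)]
      field_simp
      ring
  refine ⟨{ toFun := f, map_zero' := rfl, map_add' := hadd }, ?_, ?_⟩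
  · rintro (_ | ⟨x₁, y₁, h₁⟩) (_ | ⟨x₂, y₂, h₂⟩) h
    · rfl
    · obtain ⟨t, ht, rfl, rfl⟩ := squeezeUB_cusp_param h₂
      exact (inv_ne_zero ht ((hf ht h₂).symm.trans h.symm)).elim
    · obtain ⟨t, ht, rfl, rfl⟩ := squeezeUB_cusp_param h₁
      exact (inv_ne_zero ht ((hf ht h₁).symm.trans h)).elim
    · obtain ⟨t₁, ht₁, rfl, rfl⟩ := squeezeUB_cusp_param h₁
      obtain ⟨t₂, ht₂, rfl, rfl⟩ := squeezeUB_cusp_param h₂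
      have h' : t₁⁻¹ = t₂⁻¹ := by rw [← hf ht₁ h₁, ← hf ht₂ h₂]; exact h
      rw [inv_inj] at h'
      subst h'
      rfl
  · have := hf one_ne_zero (squeezeUB_cusp_nonsingular_param one_ne_zero)
    simpa using this

/-- `rank_ℤ ℚ = 1` (localisation does not change the rank). [folklore] -/
theorem squeezeUB_rank_int_rat : Module.rank ℤ ℚ = 1 := by
  have := IsLocalization.rank_eq ℚ (N := ℚ) (nonZeroDivisors ℤ) le_rfl
  rw [Module.rank_self] at this
  exact this.symm

/-- `finrank ℤ E_ns(ℚ) = 1` for the cusp (with this file's `DecidableEq ℚ`): `≤ 1` through the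
injection into `ℚ`, `≥ 1` because `(1,1)` has infinite order. [folklore] -/
theorem squeezeUB_cusp_finrank : Module.finrank ℤ (⟨0, 0, 0, 0, 0⟩ : WeierstrassCurve ℚ).toAffine.Point = 1 := by
  obtain ⟨φ, hφ, h1⟩ := squeezeUB_cusp_exists_addMonoidHom
  apply Module.finrank_eq_of_rank_eq
  rw [Nat.cast_one]
  refine le_antisymm ?_ ?_
  · have := LinearMap.rank_le_of_injective φ.toIntLinearMap hφ
    rwa [squeezeUB_rank_int_rat] at this
  · have hli : LinearIndependent ℤ
        ![(Affine.Point.some _ _ (squeezeUB_cusp_nonsingular_param one_ne_zero) : (⟨0, 0, 0, 0, 0⟩ : WeierstrassCurve ℚ).toAffine.Point)] := by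
      rw [Fintype.linearIndependent_iff]
      intro g hg i
      fin_cases i
      simp only [Fin.sum_univ_one, Matrix.cons_val_fin_one] at hg
      have := congrArg φ hg
      rw [map_zsmul, _root_.map_zero, h1, zsmul_eq_mul, mul_one] at this
      exact_mod_cast this
    simpa using hli.cardinal_le_rank

/-- **`rank(y² = x³) = 1`** in the sense of the tree's `WeierstrassCurve.mordellWeilRank`
(`= Module.finrank ℤ E_ns(ℚ)`, stated with the classical `DecidableEq`; `convert` bridges the
decidability instances). [folklore] -/
theorem squeezeUB_cusp_mordellWeilRank : (⟨0, 0, 0, 0, 0⟩ : WeierstrassCurve ℚ).mordellWeilRank = 1 := by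
  unfold WeierstrassCurve.mordellWeilRank
  convert squeezeUB_cusp_finrank

/-! ## The negative lemma -/

/-- **`IsElliptic` is load-bearing for `SqueezeUB` / `SqueezeUBR2` (stmt-BirchSwinnertonDyer-0145):
the crux with its only hypothesis `[W.IsElliptic]` DROPPED is false.** Witness: the cuspidal cubic
`y² = x³`, with `mordellWeilRank = 1` (`E_ns(ℚ) ≅ ℚ⁺` has `ℤ`-rank `1`, `squeezeUB_cusp_mordellWeilRank`)
and `analyticRank = 0` (`L ≡ 1`, `squeezeUB_cusp_analyticRank`). Any proof of the crux must use
`Δ ≠ 0`. [cite: SilvermanAEC2009, Prop. III.2.5 and App. C §16] -/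
theorem squeezeUB_false_without_isElliptic :
    ¬ (∀ W : WeierstrassCurve ℚ, W.mordellWeilRank ≤ W.analyticRank) := by
  intro h
  have h1 := h (⟨0, 0, 0, 0, 0⟩ : WeierstrassCurve ℚ)
  rw [squeezeUB_cusp_mordellWeilRank, squeezeUB_cusp_analyticRank] at h1
  exact Nat.not_succ_le_zero 0 h1

/-- The witness is excluded from the crux exactly by `IsElliptic` (it is not a counterexample to
`SqueezeUBR2` itself). [folklore] -/
theorem squeezeUB_cusp_not_counterexample :
    ¬ ((⟨0, 0, 0, 0, 0⟩ : WeierstrassCurve ℚ).IsElliptic ∧ (⟨0, 0, 0, 0, 0⟩ : WeierstrassCurve ℚ).analyticRank < (⟨0, 0, 0, 0, 0⟩ : WeierstrassCurve ℚ).mordellWeilRank) :=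
  fun h ↦ squeezeUB_not_isElliptic_cusp h.1

end Summit.BirchSwinnertonDyer.BirchSwinnertonDyer.Theorems
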